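import Summits.AtomisticToContinuum.HydrodynamicLimit.Theorems.ImplosionDichotomyPolynomialCompressionUniquenessIdentity
import Summits.AtomisticToContinuum.HydrodynamicLimit.Theorems.ImplosionDichotomyPolynomialCompressionUniquenessEnergy

/-!
# Entropy is transported along classical hard-sphere-Euler solutions: no cold compression

Negative-side structure (tightness of witnesses) for the crux `ImplosionDichotomy.PolynomialCompression`
(stmt-AtomisticToContinuum-12587), from the standing disprover's `Cruxes/PolynomialCompression/Disproof.lean` §12
(cycle 4). Along a classical solution `IsHardSphereEulerSolution σ T ρ u θ` whose pressure is `ρ θ ζ(ρ)` with `ζ`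
smooth on an open set `J` containing the values of the density (for the hard-sphere law, `ζ r = Z(rσ³)` on the
packing range where `Z` is smooth — automatic in the dilute regime now that `HsEosLowDensity`, stmt-0768, is a
theorem), the SPECIFIC ENTROPY `s = (3/2) log θ − log ρ − G(ρ)` (`r G′(r) = ζ(r) − 1`; for hard spheres
`G(r) = F(rσ³)`, `F` the excess free energy) satisfies the transport equation `∂ₜs + u·∇s = 0` pointwise
(`entropy_transport`: the primitive mass and temperature equations of `…UniquenessPrimitive`), hence the
renormalised conservation laws `∫ ρ Φ(s) (t) = ∫ ρ Φ(s) (0)` for every smooth `Φ` (`integral_density_mul_comp_ent_eq`)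
and the two-sided ENTROPY PRINCIPLE `min s(0,·) ≤ s(t,x) ≤ max s(0,·)` (`ent_ge_of_forall_ge`, `ent_le_of_forall_le`;
bump `Φ = expNegInvGlue (k − ·)`, positivity of `ρ`, a continuous nonnegative function with zero integral vanishes).
For the crux (sequel files): `Negative/EntropyHardSphere.lean` specialises to the typed hard-sphere law under the
`HsEosLowDensity` data (`θ ≍ ρ^{2/3}` along dilute classical solutions) and `Negative/ColdCompression.lean` refutes
the strengthening "polynomial compression at σ-uniformly bounded temperature" and sharpens the compression-set
volume to `≤ C σ^(5κ/3)`. For the provers: `entropy_transport` is step (D.3) of the lever `stub_logBudgetShadowing`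
(the entropy defect `s_σ − s₁` is transported by `u_σ`). refuter-cdisprove-stmt-AtomisticToContinuum-12587-g4-0.
-/

noncomputable section

namespace Summit.AtomisticToContinuum.HydrodynamicLimit.Theorems

/-- The SPECIFIC ENTROPY field `s(t,y) = (3/2) log θ − log ρ − G(ρ)` of density/temperature fields `(ρ, θ)`, for an
excess part `G` (`G = 0`: monatomic ideal gas; hard spheres: `G r = F(r σ³)`). -/
def PolynomialCompressionEntropy.ent (G : ℝ → ℝ)
    (ρ θ : ℝ → Literature.MathematicalPhysics.KineticTheory.T3 → ℝ) (t : ℝ)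
    (y : Literature.MathematicalPhysics.KineticTheory.T3) : ℝ :=
  3 / 2 * Real.log (θ t y) - Real.log (ρ t y) - G (ρ t y)

namespace PolynomialCompressionEntropy

open MeasureTheory Filter Set Topology
open scoped ContDiff
open Literature.MathematicalPhysics.KineticTheory Literature.Analysis.FluidPDE
open Literature.Analysis.FunctionSpaces

section General

variable {σ T : ℝ} {ρ θ : ℝ → T3 → ℝ} {u : ℝ → T3 → V3} {ζ G : ℝ → ℝ} {J : Set ℝ}

/-- `log` is smooth on `(0, ∞)`. [folklore] -/
theorem contDiffOn_log_Ioi : ContDiffOn ℝ ∞ Real.log (Ioi (0 : ℝ)) :=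
  Real.contDiffOn_log.mono fun _ hx => ne_of_gt hx

/-- The specific entropy of a classical solution is a jointly smooth space–time field (`ρ, θ > 0`, `G` smooth on an
open set containing the values of the density). [folklore] -/
theorem isSmoothSpaceTimeOn_ent (hE : IsHardSphereEulerSolution σ T ρ u θ) (hG : ContDiffOn ℝ ∞ G J)
    (hρJ : ∀ t ∈ Ico 0 T, ∀ x, ρ t x ∈ J) : Torus.IsSmoothSpaceTimeOn (Ico 0 T) (ent G ρ θ) := by
  have h1 : Torus.IsSmoothSpaceTimeOn (Ico 0 T) (fun s y => Real.log (θ s y)) :=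
    isSmoothSpaceTimeOn_comp_density hE.smooth_temperature contDiffOn_log_Ioi
      fun t ht x => hE.temperature_pos t ht x
  have h2 : Torus.IsSmoothSpaceTimeOn (Ico 0 T) (fun s y => Real.log (ρ s y)) :=
    isSmoothSpaceTimeOn_comp_density hE.smooth_density contDiffOn_log_Ioi fun t ht x => hE.density_pos t ht x
  have h3 : Torus.IsSmoothSpaceTimeOn (Ico 0 T) (fun s y => G (ρ s y)) :=
    isSmoothSpaceTimeOn_comp_density hE.smooth_density hG hρJ
  exact ((contDiffOn_const.mul h1).sub h2).sub h3

/-- Time derivative of the specific entropy along a classical solution (chain rule on the time slice). [folklore] -/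
theorem timeDerivWithin_ent (hE : IsHardSphereEulerSolution σ T ρ u θ) (hJ : IsOpen J)
    (hG : ContDiffOn ℝ ∞ G J) (hρJ : ∀ t ∈ Ico 0 T, ∀ x, ρ t x ∈ J) {t : ℝ} (ht : t ∈ Ico 0 T) (x : T3) :
    Torus.timeDerivWithin (Ico 0 T) (ent G ρ θ) t x =
      3 / 2 * ((θ t x)⁻¹ * Torus.timeDerivWithin (Ico 0 T) θ t x) -
        (ρ t x)⁻¹ * Torus.timeDerivWithin (Ico 0 T) ρ t x -
        deriv G (ρ t x) * Torus.timeDerivWithin (Ico 0 T) ρ t x := by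
  have hU : UniqueDiffOn ℝ (Ico (0 : ℝ) T) := uniqueDiffOn_Ico 0 T
  have sρ := hE.smooth_density.hasDerivWithinAt_slice ht x
  have sθ := hE.smooth_temperature.hasDerivWithinAt_slice ht x
  have hρ0 : ρ t x ≠ 0 := (hE.density_pos t ht x).ne'
  have hθ0 : θ t x ≠ 0 := (hE.temperature_pos t ht x).ne'
  have hGd : HasDerivAt G (deriv G (ρ t x)) (ρ t x) :=
    ((hG.differentiableOn (by simp)).differentiableAt (hJ.mem_nhds (hρJ t ht x))).hasDerivAt
  have hG2 : HasDerivWithinAt (fun τ => G (ρ τ x))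
      (deriv G (ρ t x) * Torus.timeDerivWithin (Ico 0 T) ρ t x) (Ico 0 T) t :=
    hGd.comp_hasDerivWithinAt t sρ
  have h : HasDerivWithinAt (fun τ => ent G ρ θ τ x)
      (3 / 2 * (Torus.timeDerivWithin (Ico 0 T) θ t x / θ t x) -
        Torus.timeDerivWithin (Ico 0 T) ρ t x / ρ t x -
        deriv G (ρ t x) * Torus.timeDerivWithin (Ico 0 T) ρ t x) (Ico 0 T) t :=
    (((sθ.log hθ0).const_mul (3 / 2)).sub (sρ.log hρ0)).sub hG2
  rw [timeDerivWithin_eq_of_hasDerivWithinAt h (hU t ht)]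
  ring

/-- Partial derivatives of the specific entropy along a classical solution (chain rule on coordinate lines).
[folklore] -/
theorem partialDeriv_ent (hE : IsHardSphereEulerSolution σ T ρ u θ) (hJ : IsOpen J)
    (hG : ContDiffOn ℝ ∞ G J) (hρJ : ∀ t ∈ Ico 0 T, ∀ x, ρ t x ∈ J) {t : ℝ} (ht : t ∈ Ico 0 T) (x : T3)
    (i : Fin 3) :
    Torus.partialDeriv i (ent G ρ θ t) x =
      3 / 2 * ((θ t x)⁻¹ * Torus.partialDeriv i (θ t) x) - (ρ t x)⁻¹ * Torus.partialDeriv i (ρ t) x -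
        deriv G (ρ t x) * Torus.partialDeriv i (ρ t) x := by
  have hρ1 : Torus.IsContDiff 1 (ρ t) := (hE.smooth_density.isSmooth_slice ht).isContDiff (by simp)
  have hθ1 : Torus.IsContDiff 1 (θ t) := (hE.smooth_temperature.isSmooth_slice ht).isContDiff (by simp)
  have cθ := hasDerivAt_coordLine_comp hθ1 isOpen_Ioi contDiffOn_log_Ioi x (hE.temperature_pos t ht x) i
  have cρ := hasDerivAt_coordLine_comp hρ1 isOpen_Ioi contDiffOn_log_Ioi x (hE.density_pos t ht x) i
  have cG := hasDerivAt_coordLine_comp hρ1 hJ hG x (hρJ t ht x) i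
  have h := ((cθ.const_mul (3 / 2)).sub cρ).sub cG
  rw [Real.deriv_log, Real.deriv_log] at h
  exact partialDeriv_eq_of_hasDerivAt h

/-- **ENTROPY TRANSPORT.** Along a classical hard-sphere-Euler solution with pressure `ρ θ ζ(ρ)` (`ζ` smooth on an
open set `J` containing the values of the density) and an excess part `G` smooth on `J` with `r G′(r) = ζ(r) − 1`,
the specific entropy `s = (3/2) log θ − log ρ − G(ρ)` satisfies `∂ₜs + u·∇s = 0` pointwise on `[0,T) × 𝕋³`
(`∂ₜθ = −u·∇θ − (2/3)θζ div u`, `∂ₜρ = −u·∇ρ − ρ div u`). [folklore] -/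
theorem entropy_transport (hE : IsHardSphereEulerSolution σ T ρ u θ) (hJ : IsOpen J)
    (hζ : ContDiffOn ℝ ∞ ζ J) (hρJ : ∀ t ∈ Ico 0 T, ∀ x, ρ t x ∈ J)
    (hp : ∀ t ∈ Ico 0 T, ∀ x, hsPressure σ (ρ t x) (θ t x) = ρ t x * θ t x * ζ (ρ t x))
    (hG : ContDiffOn ℝ ∞ G J) (hG' : ∀ r ∈ J, r * deriv G r = ζ r - 1) {t : ℝ} (ht : t ∈ Ico 0 T) (x : T3) :
    Torus.timeDerivWithin (Ico 0 T) (ent G ρ θ) t x +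
      ∑ i, u t x i * Torus.partialDeriv i (ent G ρ θ t) x = 0 := by
  rw [timeDerivWithin_ent hE hJ hG hρJ ht x]
  simp only [partialDeriv_ent hE hJ hG hρJ ht x]
  have hTρ := hsEuler_density_eq hE ht x
  have hTθ := hsEuler_temperature_eq hE hJ hζ hρJ hp ht x
  have hρi : (ρ t x)⁻¹ * ρ t x = 1 := inv_mul_cancel₀ (hE.density_pos t ht x).ne'
  have hθi : (θ t x)⁻¹ * θ t x = 1 := inv_mul_cancel₀ (hE.temperature_pos t ht x).ne'
  have hGx := hG' (ρ t x) (hρJ t ht x)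
  simp only [Fin.sum_univ_three] at hTρ hTθ ⊢
  linear_combination (3 / 2 * (θ t x)⁻¹) * hTθ - ((ρ t x)⁻¹ + deriv G (ρ t x)) * hTρ -
    (ζ (ρ t x) * (Torus.partialDeriv 0 (fun y => u t y 0) x + Torus.partialDeriv 1 (fun y => u t y 1) x +
      Torus.partialDeriv 2 (fun y => u t y 2) x)) * hθi +
    (Torus.partialDeriv 0 (fun y => u t y 0) x + Torus.partialDeriv 1 (fun y => u t y 1) x +
      Torus.partialDeriv 2 (fun y => u t y 2) x) * hρi +
    (Torus.partialDeriv 0 (fun y => u t y 0) x + Torus.partialDeriv 1 (fun y => u t y 1) x +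
      Torus.partialDeriv 2 (fun y => u t y 2) x) * hGx

/-- **Renormalised entropy balance, pointwise**: for every smooth `Φ : ℝ → ℝ`, the field `W = ρ Φ(s)` satisfies the
conservation law `∂ₜW + div(W u) = 0` on `[0,T) × 𝕋³` (mass equation + entropy transport). [folklore] -/
theorem timeDerivWithin_density_mul_comp_ent (hE : IsHardSphereEulerSolution σ T ρ u θ) (hJ : IsOpen J)
    (hζ : ContDiffOn ℝ ∞ ζ J) (hρJ : ∀ t ∈ Ico 0 T, ∀ x, ρ t x ∈ J)
    (hp : ∀ t ∈ Ico 0 T, ∀ x, hsPressure σ (ρ t x) (θ t x) = ρ t x * θ t x * ζ (ρ t x))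
    (hG : ContDiffOn ℝ ∞ G J) (hG' : ∀ r ∈ J, r * deriv G r = ζ r - 1) {Φ : ℝ → ℝ} (hΦ : ContDiff ℝ ∞ Φ)
    {t : ℝ} (ht : t ∈ Ico 0 T) (x : T3) :
    Torus.timeDerivWithin (Ico 0 T) (fun s y => ρ s y * Φ (ent G ρ θ s y)) t x +
      Torus.divergence (fun y => (ρ t y * Φ (ent G ρ θ t y)) • u t y) x = 0 := by
  have hU : UniqueDiffOn ℝ (Ico (0 : ℝ) T) := uniqueDiffOn_Ico 0 T
  have hent := isSmoothSpaceTimeOn_ent hE hG hρJ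
  have hρ1 : Torus.IsContDiff 1 (ρ t) := (hE.smooth_density.isSmooth_slice ht).isContDiff (by simp)
  have hu1 : Torus.IsContDiff 1 (u t) := (hE.smooth_velocity.isSmooth_slice ht).isContDiff (by simp)
  have huj1 : ∀ i, Torus.IsContDiff 1 (fun y => u t y i) := fun i => isContDiff_apply_coord hu1 i
  have he1 : Torus.IsContDiff 1 (ent G ρ θ t) := (hent.isSmooth_slice ht).isContDiff (by simp)
  -- one-variable derivatives of the basic fields
  have sρ := hE.smooth_density.hasDerivWithinAt_slice ht x
  have se := hent.hasDerivWithinAt_slice ht x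
  have cρ := fun i => hasDerivAt_coordLine hρ1 x i
  have cu := fun i k => hasDerivAt_coordLine (huj1 k) x i
  have ce := fun i => hasDerivAt_coordLine he1 x i
  have hΦd : ∀ r, HasDerivAt Φ (deriv Φ r) r := fun r =>
    ((hΦ.differentiable (by simp)).differentiableAt).hasDerivAt
  -- (1) the time derivative of `W`
  have hΦt : HasDerivWithinAt (fun τ => Φ (ent G ρ θ τ x))
      (deriv Φ (ent G ρ θ t x) * Torus.timeDerivWithin (Ico 0 T) (ent G ρ θ) t x) (Ico 0 T) t :=
    (hΦd _).comp_hasDerivWithinAt t se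
  have hA : Torus.timeDerivWithin (Ico 0 T) (fun s y => ρ s y * Φ (ent G ρ θ s y)) t x =
      Torus.timeDerivWithin (Ico 0 T) ρ t x * Φ (ent G ρ θ t x) +
        ρ t x * (deriv Φ (ent G ρ θ t x) * Torus.timeDerivWithin (Ico 0 T) (ent G ρ θ) t x) :=
    timeDerivWithin_eq_of_hasDerivWithinAt (sρ.mul hΦt) (hU t ht)
  -- (2) the divergence of the flux, coordinate by coordinate
  have hΦx : ∀ i, HasDerivAt (fun s : ℝ => Φ (ent G ρ θ t (x + Torus.proj (s • EuclideanSpace.single i (1 : ℝ)))))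
      (deriv Φ (ent G ρ θ t x) * Torus.partialDeriv i (ent G ρ θ t) x) 0 := by
    intro i
    have h := (hΦd (ent G ρ θ t (x + Torus.proj ((0 : ℝ) • EuclideanSpace.single i (1 : ℝ))))).comp 0 (ce i)
    simpa only [zero_smul, Torus.proj_zero, add_zero, Function.comp_def] using h
  have hB : ∀ i, Torus.partialDeriv i (fun y => ((ρ t y * Φ (ent G ρ θ t y)) • u t y) i) x =
      (Torus.partialDeriv i (ρ t) x * Φ (ent G ρ θ t x) +
          ρ t x * (deriv Φ (ent G ρ θ t x) * Torus.partialDeriv i (ent G ρ θ t) x)) * u t x i +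
        ρ t x * Φ (ent G ρ θ t x) * Torus.partialDeriv i (fun y => u t y i) x := by
    intro i
    have hfun : (fun y => ((ρ t y * Φ (ent G ρ θ t y)) • u t y) i) =
        fun y => ρ t y * Φ (ent G ρ θ t y) * u t y i := by
      funext y; simp [smul_eq_mul]
    rw [hfun]
    exact partialDeriv_eq_of_hasDerivAt ((((cρ i).fun_mul (hΦx i)).fun_mul (cu i i)).congr_deriv
      (by simp only [zero_smul, Torus.proj_zero, add_zero]))
  have hmass := hsEuler_density_eq hE ht x
  have htr := entropy_transport hE hJ hζ hρJ hp hG hG' ht x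
  unfold Torus.divergence
  rw [hA]
  simp only [hB]
  simp only [Fin.sum_univ_three] at hmass htr ⊢
  linear_combination (Φ (ent G ρ θ t x)) * hmass + (ρ t x * deriv Φ (ent G ρ θ t x)) * htr

/-- **Renormalised entropy conservation**: along such a solution, `∫ ρ Φ(s) (t) = ∫ ρ Φ(s) (0)` for every smooth
`Φ : ℝ → ℝ` and `t ∈ [0,T)` (divergence theorem on `𝕋³`, differentiation under `∫`, one-sided mean value theorem).
[folklore] -/
theorem integral_density_mul_comp_ent_eq (hE : IsHardSphereEulerSolution σ T ρ u θ) (hJ : IsOpen J)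
    (hζ : ContDiffOn ℝ ∞ ζ J) (hρJ : ∀ t ∈ Ico 0 T, ∀ x, ρ t x ∈ J)
    (hp : ∀ t ∈ Ico 0 T, ∀ x, hsPressure σ (ρ t x) (θ t x) = ρ t x * θ t x * ζ (ρ t x))
    (hG : ContDiffOn ℝ ∞ G J) (hG' : ∀ r ∈ J, r * deriv G r = ζ r - 1) {Φ : ℝ → ℝ} (hΦ : ContDiff ℝ ∞ Φ)
    {t : ℝ} (ht : t ∈ Ico 0 T) :
    ∫ x, ρ t x * Φ (ent G ρ θ t x) = ∫ x, ρ 0 x * Φ (ent G ρ θ 0 x) := by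
  have hent := isSmoothSpaceTimeOn_ent hE hG hρJ
  have hΦe : Torus.IsSmoothSpaceTimeOn (Ico 0 T) (fun s y => Φ (ent G ρ θ s y)) := hΦ.comp_contDiffOn hent
  have hW : Torus.IsSmoothSpaceTimeOn (Ico 0 T) (fun s y => ρ s y * Φ (ent G ρ θ s y)) :=
    hE.smooth_density.mul hΦe
  have hflux : Torus.IsSmoothSpaceTimeOn (Ico 0 T) (fun s y => (ρ s y * Φ (ent G ρ θ s y)) • u s y) :=
    hW.smul hE.smooth_velocity
  have hderiv : ∀ s ∈ Ico 0 T,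
      HasDerivWithinAt (fun s => ∫ x, ρ s x * Φ (ent G ρ θ s x)) 0 (Ico 0 T) s := by
    intro s hs
    have h1 := hW.hasDerivWithinAt_integral (convex_Ico 0 T) hs
    have h2 : ∫ x, Torus.timeDerivWithin (Ico 0 T) (fun s y => ρ s y * Φ (ent G ρ θ s y)) s x = 0 := by
      have hpt : (fun x => Torus.timeDerivWithin (Ico 0 T) (fun s y => ρ s y * Φ (ent G ρ θ s y)) s x) =
          fun x => -Torus.divergence (fun y => (ρ s y * Φ (ent G ρ θ s y)) • u s y) x := by
        funext x
        have := timeDerivWithin_density_mul_comp_ent hE hJ hζ hρJ hp hG hG' hΦ hs x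
        linarith
      rw [hpt, integral_neg, neg_eq_zero]
      exact Torus.integral_divergence_eq_zero_holds (hflux.isSmooth_slice hs)
    rwa [h2] at h1
  have hcont : ContinuousOn (fun s => ∫ x, ρ s x * Φ (ent G ρ θ s x)) (Icc 0 t) := fun s hs =>
    ((hderiv s ⟨hs.1, hs.2.trans_lt ht.2⟩).continuousWithinAt).mono (Icc_subset_Ico_right ht.2)
  have hright : ∀ s ∈ Ico 0 t,
      HasDerivWithinAt (fun s => ∫ x, ρ s x * Φ (ent G ρ θ s x)) 0 (Ici s) s := by
    intro s hs
    have hsT : s ∈ Ico 0 T := ⟨hs.1, hs.2.trans ht.2⟩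
    refine (hderiv s hsT).mono_of_mem_nhdsWithin ?_
    exact Filter.mem_of_superset (Ico_mem_nhdsGE hsT.2) (Ico_subset_Ico_left hsT.1)
  exact constant_of_has_deriv_right_zero hcont hright t (right_mem_Icc.2 ht.1)

/-- **ENTROPY MINIMUM PRINCIPLE**: a lower bound of the specific entropy at `t = 0` persists on `[0,T) × 𝕋³`
(renormalised conservation with the smooth bump `Φ = expNegInvGlue (k − ·)`, which vanishes exactly on `[k, ∞)`;
`ρ > 0`; a continuous nonnegative function on `𝕋³` with zero integral vanishes). [folklore] -/
theorem ent_ge_of_forall_ge (hE : IsHardSphereEulerSolution σ T ρ u θ) (hJ : IsOpen J)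
    (hζ : ContDiffOn ℝ ∞ ζ J) (hρJ : ∀ t ∈ Ico 0 T, ∀ x, ρ t x ∈ J)
    (hp : ∀ t ∈ Ico 0 T, ∀ x, hsPressure σ (ρ t x) (θ t x) = ρ t x * θ t x * ζ (ρ t x))
    (hG : ContDiffOn ℝ ∞ G J) (hG' : ∀ r ∈ J, r * deriv G r = ζ r - 1) {k : ℝ}
    (hk : ∀ y, k ≤ ent G ρ θ 0 y) {t : ℝ} (ht : t ∈ Ico 0 T) (x : T3) : k ≤ ent G ρ θ t x := by
  set Φ : ℝ → ℝ := fun r => expNegInvGlue (k - r) with hΦ_def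
  have hΦ : ContDiff ℝ ∞ Φ := expNegInvGlue.contDiff.comp (contDiff_const.sub contDiff_id)
  have hcons := integral_density_mul_comp_ent_eq hE hJ hζ hρJ hp hG hG' hΦ ht
  have h0 : ∫ x, ρ 0 x * Φ (ent G ρ θ 0 x) = 0 := by
    have : (fun x => ρ 0 x * Φ (ent G ρ θ 0 x)) = fun _ => 0 := by
      funext y
      show ρ 0 y * expNegInvGlue (k - ent G ρ θ 0 y) = 0
      rw [expNegInvGlue.zero_of_nonpos (sub_nonpos.2 (hk y)), mul_zero]
    rw [this, integral_zero]
  rw [h0] at hcons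
  have hent := isSmoothSpaceTimeOn_ent hE hG hρJ
  have hΦe : Torus.IsSmoothSpaceTimeOn (Ico 0 T) (fun s y => Φ (ent G ρ θ s y)) := hΦ.comp_contDiffOn hent
  have hcontW : Continuous fun y => ρ t y * Φ (ent G ρ θ t y) :=
    ((hE.smooth_density.mul hΦe).isSmooth_slice ht).continuous
  have hnn : ∀ y, 0 ≤ ρ t y * Φ (ent G ρ θ t y) := fun y =>
    mul_nonneg (hE.density_pos t ht y).le (expNegInvGlue.nonneg _)
  have hzero := eq_zero_of_integral_eq_zero_of_nonneg hcontW hnn hcons x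
  have hΦ0 : Φ (ent G ρ θ t x) = 0 := (mul_eq_zero.1 hzero).resolve_left (hE.density_pos t ht x).ne'
  have := expNegInvGlue.zero_iff_nonpos.1 hΦ0
  linarith

/-- **ENTROPY MAXIMUM PRINCIPLE**: an upper bound of the specific entropy at `t = 0` persists on `[0,T) × 𝕋³`.
[folklore] -/
theorem ent_le_of_forall_le (hE : IsHardSphereEulerSolution σ T ρ u θ) (hJ : IsOpen J)
    (hζ : ContDiffOn ℝ ∞ ζ J) (hρJ : ∀ t ∈ Ico 0 T, ∀ x, ρ t x ∈ J)
    (hp : ∀ t ∈ Ico 0 T, ∀ x, hsPressure σ (ρ t x) (θ t x) = ρ t x * θ t x * ζ (ρ t x))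
    (hG : ContDiffOn ℝ ∞ G J) (hG' : ∀ r ∈ J, r * deriv G r = ζ r - 1) {K : ℝ}
    (hK : ∀ y, ent G ρ θ 0 y ≤ K) {t : ℝ} (ht : t ∈ Ico 0 T) (x : T3) : ent G ρ θ t x ≤ K := by
  set Φ : ℝ → ℝ := fun r => expNegInvGlue (r - K) with hΦ_def
  have hΦ : ContDiff ℝ ∞ Φ := expNegInvGlue.contDiff.comp (contDiff_id.sub contDiff_const)
  have hcons := integral_density_mul_comp_ent_eq hE hJ hζ hρJ hp hG hG' hΦ ht
  have h0 : ∫ x, ρ 0 x * Φ (ent G ρ θ 0 x) = 0 := by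
    have : (fun x => ρ 0 x * Φ (ent G ρ θ 0 x)) = fun _ => 0 := by
      funext y
      show ρ 0 y * expNegInvGlue (ent G ρ θ 0 y - K) = 0
      rw [expNegInvGlue.zero_of_nonpos (sub_nonpos.2 (hK y)), mul_zero]
    rw [this, integral_zero]
  rw [h0] at hcons
  have hent := isSmoothSpaceTimeOn_ent hE hG hρJ
  have hΦe : Torus.IsSmoothSpaceTimeOn (Ico 0 T) (fun s y => Φ (ent G ρ θ s y)) := hΦ.comp_contDiffOn hent
  have hcontW : Continuous fun y => ρ t y * Φ (ent G ρ θ t y) :=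
    ((hE.smooth_density.mul hΦe).isSmooth_slice ht).continuous
  have hnn : ∀ y, 0 ≤ ρ t y * Φ (ent G ρ θ t y) := fun y =>
    mul_nonneg (hE.density_pos t ht y).le (expNegInvGlue.nonneg _)
  have hzero := eq_zero_of_integral_eq_zero_of_nonneg hcontW hnn hcons x
  have hΦ0 : Φ (ent G ρ θ t x) = 0 := (mul_eq_zero.1 hzero).resolve_left (hE.density_pos t ht x).ne'
  have := expNegInvGlue.zero_iff_nonpos.1 hΦ0
  linarith

end General

section IdealGas

variable {T : ℝ} {ρ θ : ℝ → T3 → ℝ} {u : ℝ → T3 → V3}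

/-- At `σ = 0` the typed pressure is the monatomic ideal-gas law `p = ρθ` (`Z(0) = 1 + 0·(deriv junk) = 1`). [folklore] -/
theorem hsPressure_zero_eq (r ϑ : ℝ) : hsPressure 0 r ϑ = r * ϑ * (fun _ : ℝ => (1 : ℝ)) r := by
  simp [hsPressure, hsCompressibility]

/-- **ISENTROPY IS PROPAGATED (σ = 0).** A classical ideal-gas solution (`IsHardSphereEulerSolution 0 T`) with
isentropic DATA `θ(0) = K ρ(0)^{2/3}` is isentropic at all times: `θ(t) = K ρ(t)^{2/3}` on `[0,T) × 𝕋³` (entropy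
min = max principle with `ζ ≡ 1`, `G ≡ 0`). For the line `log-lipschitz-budget`: the hypothesis `hisen` of
`stub_logBudgetShadowing` / clause of `stub_typeOneImplosion` follows from its `t = 0` instance and `hsol₁`. [folklore] -/
theorem ideal_isentropic_of_data (hE : IsHardSphereEulerSolution 0 T ρ u θ) {K : ℝ} (hK : 0 < K)
    (h0 : ∀ y, θ 0 y = K * ρ 0 y ^ (2 / 3 : ℝ)) {t : ℝ} (ht : t ∈ Ico 0 T) (x : T3) :
    θ t x = K * ρ t x ^ (2 / 3 : ℝ) := by
  have hT : 0 < T := ht.1.trans_lt ht.2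
  have h0mem : (0 : ℝ) ∈ Ico 0 T := ⟨le_rfl, hT⟩
  have hζ : ContDiffOn ℝ ∞ (fun _ : ℝ => (1 : ℝ)) univ := contDiffOn_const
  have hG : ContDiffOn ℝ ∞ (fun _ : ℝ => (0 : ℝ)) univ := contDiffOn_const
  have hG' : ∀ r ∈ (univ : Set ℝ), r * deriv (fun _ : ℝ => (0 : ℝ)) r = (fun _ : ℝ => (1 : ℝ)) r - 1 := by
    intro r _; simp
  have hρJ : ∀ t ∈ Ico 0 T, ∀ x, ρ t x ∈ (univ : Set ℝ) := fun _ _ _ => mem_univ _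
  have hp : ∀ t ∈ Ico 0 T, ∀ x, hsPressure 0 (ρ t x) (θ t x) = ρ t x * θ t x * (fun _ : ℝ => (1 : ℝ)) (ρ t x) :=
    fun t _ x => hsPressure_zero_eq _ _
  -- the data entropy is the constant `(3/2) log K`
  have hs0 : ∀ y, ent (fun _ => 0) ρ θ 0 y = 3 / 2 * Real.log K := by
    intro y
    have hρ0 := hE.density_pos 0 h0mem y
    unfold ent
    rw [h0 y, Real.log_mul hK.ne' (Real.rpow_pos_of_pos hρ0 _).ne', Real.log_rpow hρ0]
    ring
  have hge := ent_ge_of_forall_ge hE isOpen_univ hζ hρJ hp hG hG' (k := 3 / 2 * Real.log K)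
    (fun y => (hs0 y).ge) ht x
  have hle := ent_le_of_forall_le hE isOpen_univ hζ hρJ hp hG hG' (K := 3 / 2 * Real.log K)
    (fun y => (hs0 y).le) ht x
  have hρ := hE.density_pos t ht x
  have hθ := hE.temperature_pos t ht x
  unfold ent at hge hle
  have hlog : Real.log (θ t x) = Real.log K + Real.log (ρ t x) * (2 / 3) := by linarith
  calc θ t x = Real.exp (Real.log (θ t x)) := (Real.exp_log hθ).symm
    _ = K * ρ t x ^ (2 / 3 : ℝ) := by
        rw [hlog, Real.exp_add, Real.exp_log hK, Real.rpow_def_of_pos hρ]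

end IdealGas

end PolynomialCompressionEntropy

end Summit.AtomisticToContinuum.HydrodynamicLimit.Theorems

end
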